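import Summits.CriticalPhenomena.PercolationContinuityZ3.Theorems.PercNearOneGluingNoHeavyLowerTailStarSetTrianglePointwise
import HarnessLib

/-!
# `NoHeavyLowerTail` (stmt-CriticalPhenomena-4575) — the comonotone word WITH HAIR BUDGET for the TRIANGLE (level `j ≤ 2`)

Support file (prover `prim-gen-swap` gen 9; `--supports stmt-CriticalPhenomena-4575`).  No definitions, no named facts, no sorries.

Three two-port pendant stars `s i` (`i : Fin 3`) on a TRIANGLE of relays `q 0, q 1, q 2`: star `i` has the ports `p i = q (i+1)` and
`p' i = q (i+2)` (it is "opposite" to the port `q i`).  The port graph is a cycle of length three, so neither the forest certificate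
(`StarSet.comonotone_word_nonneg_forest`) nor its class version applies; the seat memos CYCLES-CERT.md §2–§6 / TRIANGLE-PROOF.md show that the
comonotone word ALONE is not certifiable from the champion rows, but that it is once the two "rotation" words (every star glued to a
distinct port) are kept as a budget.  This file proves the integrated form of that certificate:

* `StarSet.triangle_certificate_pointwise` — pointwise in the configuration off the stars, the instantiation of the algebraic core
  `StarSet.triangleCertificate_core₂` (c-trichotomy, loneliness facts of the triangle);
* `StarSet.comonotone_word_budget_triangle` — for constants `C0, C3 ≥ 0` with `Σ_i θ_i > 2 → C0 ≤ 2·C3`: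
  `0 ≤ C0 · Σ_σ w(σ)·[μ(c ↮_ξ P_σ, |π_ξ(c)| ≤ j) − μ(c ↮_ξ P_σ, 1 ≤ |π_ξ(P_σ)| ≤ j)] + C3 · μ(c ↮_ξ {q 0, q 1, q 2}, |π_ξ(c)| ≤ j)`
  whenever `c ∈ A` off the ports dominates the three ports.
The assembly (extreme regrouping, glued words, the two rotation words) is the sequel file …StarSetTriangleLevelTwo.
-/

noncomputable section

namespace Summit.CriticalPhenomena.PercolationContinuityZ3.Theorems

open MeasureTheory Set Literature.Probability.LatticeModels Literature.Probability.Percolation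
open scoped Classical BigOperators

variable {n : ℕ}

namespace StarSet

/-- **The triangle certificate, pointwise in the configuration off the stars** (`ξ = ω` off the stars, links `L_σ`, `x_d = (1−θ_d)/(3−Σθ)`
if `Σθ ≤ 2`, else `1/2`): `Σ_d C0·x_d·Σ_σ W(σ)([|π_{ξ∪L_σ}(c)| ≤ j] − [|π_{ξ∪L_σ}(q d)| ≤ j]) ≤ C0·Σ_σ W(σ)([c ↮_ξ P_σ, |π_ξ(c)| ≤ j] −
[c ↮_ξ P_σ, 1 ≤ |π_ξ(P_σ)| ≤ j]) + C3·[c ↮_ξ q, |π_ξ(c)| ≤ j]`; instantiation of `StarSet.triangleCertificate_core₂`. [TRIANGLE-PROOF.md §4] -/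
theorem triangle_certificate_pointwise (w : Sym2 (Fin n) → unitInterval) (A : Finset (Fin n)) (s p p' q : Fin 3 → Fin n)
    (hp : ∀ i, p i = q (i + 1)) (hp' : ∀ i, p' i = q (i + 2))
    (c : Fin n) (j : ℕ) (hj : j ≤ 2)
    (hqA : ∀ d, q d ∈ A) (hq : Function.Injective q) (hcA : c ∈ A) (hcq : ∀ d, c ≠ q d)
    (C0 C3 : ℝ) (hC0 : 0 ≤ C0) (hC3 : 0 ≤ C3)
    (hbudget : 2 < ∑ i, (w s(s i, p i) : ℝ) * w s(s i, p' i) → C0 ≤ 2 * C3) (ω : BondConfig (Fin n)) :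
    ∑ d, (C0 * (if ∑ i, (w s(s i, p i) : ℝ) * w s(s i, p' i) ≤ 2 then
        (1 - (w s(s d, p d) : ℝ) * w s(s d, p' d)) / (3 - ∑ i, (w s(s i, p i) : ℝ) * w s(s i, p' i)) else 1 / 2)) *
      ∑ σ ∈ (Finset.univ : Finset (Fin 3)).powerset,
        ((∏ i ∈ σ, ((w s(s i, p i) : ℝ) * w s(s i, p' i))) * ∏ i ∈ Finset.univ \ σ, (1 - (w s(s i, p i) : ℝ) * w s(s i, p' i))) *
        (DecisionTree.ind {ω' : BondConfig (Fin n) |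
            (A.filter fun z => (openGraph ((ω' ∩ {e | ∀ v ∈ Finset.univ.image s, v ∉ e}) ∪
              ↑(σ.image fun i => (s(p i, p' i) : Sym2 (Fin n))))).Reachable c z).card ≤ j} ω -
          DecisionTree.ind {ω' : BondConfig (Fin n) |
            (A.filter fun z => (openGraph ((ω' ∩ {e | ∀ v ∈ Finset.univ.image s, v ∉ e}) ∪
              ↑(σ.image fun i => (s(p i, p' i) : Sym2 (Fin n))))).Reachable (q d) z).card ≤ j} ω) ≤
    C0 * ∑ σ ∈ (Finset.univ : Finset (Fin 3)).powerset,
        ((∏ i ∈ σ, ((w s(s i, p i) : ℝ) * w s(s i, p' i))) * ∏ i ∈ Finset.univ \ σ, (1 - (w s(s i, p i) : ℝ) * w s(s i, p' i))) *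
        (DecisionTree.ind {ω' : BondConfig (Fin n) |
            (∀ u ∈ σ.image p ∪ σ.image p', ¬ (openGraph (ω' ∩ {e | ∀ v ∈ Finset.univ.image s, v ∉ e})).Reachable c u) ∧
            (A.filter fun z => (openGraph (ω' ∩ {e | ∀ v ∈ Finset.univ.image s, v ∉ e})).Reachable c z).card ≤ j} ω -
          DecisionTree.ind {ω' : BondConfig (Fin n) |
            (∀ u ∈ σ.image p ∪ σ.image p', ¬ (openGraph (ω' ∩ {e | ∀ v ∈ Finset.univ.image s, v ∉ e})).Reachable c u) ∧
            1 ≤ (A.filter fun z => ∃ u ∈ σ.image p ∪ σ.image p',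
              (openGraph (ω' ∩ {e | ∀ v ∈ Finset.univ.image s, v ∉ e})).Reachable u z).card ∧
            (A.filter fun z => ∃ u ∈ σ.image p ∪ σ.image p',
              (openGraph (ω' ∩ {e | ∀ v ∈ Finset.univ.image s, v ∉ e})).Reachable u z).card ≤ j} ω) +
      C3 * DecisionTree.ind {ω' : BondConfig (Fin n) |
          (∀ d, ¬ (openGraph (ω' ∩ {e | ∀ v ∈ Finset.univ.image s, v ∉ e})).Reachable c (q d)) ∧
          (A.filter fun z => (openGraph (ω' ∩ {e | ∀ v ∈ Finset.univ.image s, v ∉ e})).Reachable c z).card ≤ j} ω := by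
  -- port facts
  have hpA : ∀ i, p i ∈ A := fun i => (hp i) ▸ hqA (i + 1)
  have hp'A : ∀ i, p' i ∈ A := fun i => (hp' i) ▸ hqA (i + 2)
  have hpp' : ∀ i, p i ≠ p' i := fun i h => (fin3_facts i).2.2.1 (hq (((hp i).symm.trans h).trans (hp' i)))
  have hcp : ∀ i, c ≠ p i ∧ c ≠ p' i := fun i => ⟨(hp i) ▸ hcq (i + 1), (hp' i) ▸ hcq (i + 2)⟩
  have hqport : ∀ i d, d ≠ i → q d = p i ∨ q d = p' i := fun i d hdi =>
    ((fin3_ne_iff i d).1 hdi).elim (fun h => Or.inl (h ▸ (hp i).symm)) (fun h => Or.inr (h ▸ (hp' i).symm))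
  -- no two stars have the same pair of ports
  have hnopar : ∀ i k : Fin 3, i ≠ k → ¬ ((p k = p i ∨ p k = p' i) ∧ (p' k = p i ∨ p' k = p' i)) := by
    intro i k hik h
    rw [hp i, hp' i, hp k, hp' k] at h
    have h' : (k + 1 = i + 1 ∨ k + 1 = i + 2) ∧ (k + 2 = i + 1 ∨ k + 2 = i + 2) :=
      ⟨h.1.imp (fun e => hq e) (fun e => hq e), h.2.imp (fun e => hq e) (fun e => hq e)⟩
    exact fin3_nopar i k hik h'
  -- abbreviations
  set θ : Fin 3 → ℝ := fun i => (w s(s i, p i) : ℝ) * w s(s i, p' i) with hθ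
  have hθ0 : ∀ i, 0 ≤ θ i := fun i => mul_nonneg (w _).2.1 (w _).2.1
  have hθ1 : ∀ i, θ i ≤ 1 := fun i => mul_le_one₀ (w _).2.2 (w _).2.1 (w _).2.2
  set W : Finset (Fin 3) → ℝ := fun σ => (∏ i ∈ σ, θ i) * ∏ i ∈ Finset.univ \ σ, (1 - θ i) with hW
  set ξ : BondConfig (Fin n) := ω ∩ {e | ∀ v ∈ Finset.univ.image s, v ∉ e} with hξ
  set G : Finset (Fin 3) → Set (BondConfig (Fin n)) := fun σ => {ω' |
    (A.filter fun z => (openGraph ((ω' ∩ {e | ∀ v ∈ Finset.univ.image s, v ∉ e}) ∪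
      ↑(σ.image fun i => (s(p i, p' i) : Sym2 (Fin n))))).Reachable c z).card ≤ j} with hG
  set Sp : Fin 3 → Finset (Fin 3) → Set (BondConfig (Fin n)) := fun d σ => {ω' |
    (A.filter fun z => (openGraph ((ω' ∩ {e | ∀ v ∈ Finset.univ.image s, v ∉ e}) ∪
      ↑(σ.image fun i => (s(p i, p' i) : Sym2 (Fin n))))).Reachable (q d) z).card ≤ j} with hSp
  set D₁ : Finset (Fin 3) → Set (BondConfig (Fin n)) := fun σ => {ω' |
    (∀ u ∈ σ.image p ∪ σ.image p', ¬ (openGraph (ω' ∩ {e | ∀ v ∈ Finset.univ.image s, v ∉ e})).Reachable c u) ∧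
      (A.filter fun z => (openGraph (ω' ∩ {e | ∀ v ∈ Finset.univ.image s, v ∉ e})).Reachable c z).card ≤ j} with hD₁
  set D₂ : Finset (Fin 3) → Set (BondConfig (Fin n)) := fun σ => {ω' |
    (∀ u ∈ σ.image p ∪ σ.image p', ¬ (openGraph (ω' ∩ {e | ∀ v ∈ Finset.univ.image s, v ∉ e})).Reachable c u) ∧
      1 ≤ (A.filter fun z => ∃ u ∈ σ.image p ∪ σ.image p',
        (openGraph (ω' ∩ {e | ∀ v ∈ Finset.univ.image s, v ∉ e})).Reachable u z).card ∧
      (A.filter fun z => ∃ u ∈ σ.image p ∪ σ.image p',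
        (openGraph (ω' ∩ {e | ∀ v ∈ Finset.univ.image s, v ∉ e})).Reachable u z).card ≤ j} with hD₂
  set Chi : Set (BondConfig (Fin n)) := {ω' |
    (∀ d, ¬ (openGraph (ω' ∩ {e | ∀ v ∈ Finset.univ.image s, v ∉ e})).Reachable c (q d)) ∧
      (A.filter fun z => (openGraph (ω' ∩ {e | ∀ v ∈ Finset.univ.image s, v ∉ e})).Reachable c z).card ≤ j} with hChi
  change ∑ d, (C0 * (if ∑ i, θ i ≤ 2 then (1 - θ d) / (3 - ∑ i, θ i) else 1 / 2)) *
      ∑ σ ∈ (Finset.univ : Finset (Fin 3)).powerset, W σ * (DecisionTree.ind (G σ) ω - DecisionTree.ind (Sp d σ) ω) ≤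
    C0 * ∑ σ ∈ (Finset.univ : Finset (Fin 3)).powerset, W σ * (DecisionTree.ind (D₁ σ) ω - DecisionTree.ind (D₂ σ) ω) +
      C3 * DecisionTree.ind Chi ω
  -- (0) `D₁ σ = G σ` (ρ-part of the link representation)
  have hi : ∀ σ, DecisionTree.ind (D₁ σ) ω = DecisionTree.ind (G σ) ω := by
    intro σ
    have hΛ : ∀ l ∈ σ.image (fun i => (s(p i, p' i) : Sym2 (Fin n))),
        ∃ r r', l = s(r, r') ∧ r ≠ r' ∧ r ∈ A ∧ r' ∈ A ∧ r ≠ c ∧ r' ≠ c := by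
      intro l hl
      obtain ⟨i, -, rfl⟩ := Finset.mem_image.1 hl
      exact ⟨p i, p' i, rfl, hpp' i, hpA i, hp'A i, (hcp i).1.symm, (hcp i).2.symm⟩
    have key := sepSmall_links_iff ξ (σ.image fun i => (s(p i, p' i) : Sym2 (Fin n))) A ∅ c j hj hcA hΛ
    have hiff : ω ∈ D₁ σ ↔ ω ∈ G σ := by
      simp only [hD₁, hG, mem_setOf_eq]
      constructor
      · rintro ⟨hsep, hsmall⟩
        have h3 := key.1 ⟨fun y hy => absurd hy (Finset.notMem_empty y),
          fun l hl v hv => hsep v ((mem_portPattern_iff p p' σ v).2 ⟨l, hl, hv⟩), by convert hsmall using 4⟩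
        convert h3.2 using 4
      · intro hsmall
        have h3 := key.2 ⟨fun y hy => absurd hy (Finset.notMem_empty y), by convert hsmall using 4⟩
        refine ⟨fun u hu => ?_, by convert h3.2.2 using 4⟩
        obtain ⟨l, hl, hul⟩ := (mem_portPattern_iff p p' σ u).1 hu
        exact h3.2.1 l hl u hul
    by_cases hω : ω ∈ D₁ σ
    · rw [DecisionTree.ind_of_mem hω, DecisionTree.ind_of_mem (hiff.1 hω)]
    · rw [DecisionTree.ind_of_not_mem hω, DecisionTree.ind_of_not_mem (fun h => hω (hiff.2 h))]
  have hrhs : ∑ σ ∈ (Finset.univ : Finset (Fin 3)).powerset, W σ * (DecisionTree.ind (D₁ σ) ω - DecisionTree.ind (D₂ σ) ω) =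
      ∑ σ ∈ (Finset.univ : Finset (Fin 3)).powerset, W σ * (DecisionTree.ind (G σ) ω - DecisionTree.ind (D₂ σ) ω) :=
    Finset.sum_congr rfl fun σ _ => by rw [hi σ]
  rw [hrhs]
  -- trivial case `C0 = 0`
  rcases eq_or_lt_of_le hC0 with hC00 | hC0pos
  · rw [← hC00]
    simp only [zero_mul, Finset.sum_const_zero, zero_add]
    exact mul_nonneg hC3 (DecisionTree.ind_nonneg _ _)
  -- loneliness data of a lonely-capable star
  have hlonelyOf : ∀ i, DecisionTree.ind (D₂ {i}) ω ≠ 0 →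
      (∀ u ∈ ({i} : Finset (Fin 3)).image p ∪ ({i} : Finset (Fin 3)).image p', ¬ (openGraph ξ).Reachable c u) ∧
      (A.filter fun z => ∃ u ∈ ({i} : Finset (Fin 3)).image p ∪ ({i} : Finset (Fin 3)).image p',
        (openGraph ξ).Reachable u z).card ≤ j := by
    intro i hne
    by_cases hω : ω ∈ D₂ {i}
    · simp only [hD₂, mem_setOf_eq] at hω
      exact ⟨hω.1, hω.2.2⟩
    · exact absurd (DecisionTree.ind_of_not_mem hω) hne
  have hports : ∀ i σ, DecisionTree.ind (D₂ {i}) ω ≠ 0 → (∀ k ∈ σ, k ≠ i → ¬ (p k = p i ∨ p k = p' i ∨ p' k = p i ∨ p' k = p' i)) →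
      ∀ d, d ≠ i → DecisionTree.ind (Sp d σ) ω = 1 := by
    intro i σ hne hσ d hdi
    have h2 := lonely_ports_light_adj ξ A p p' i σ j hj hpA hp'A hpp' ((card_filter_congr fun _ _ => Iff.rfl).trans_le (hlonelyOf i hne).2) hσ
    refine DecisionTree.ind_of_mem ?_
    simp only [hSp, mem_setOf_eq]
    rcases hqport i d hdi with hd | hd
    · rw [hd]; exact (card_filter_congr fun _ _ => Iff.rfl).trans_le h2.1
    · rw [hd]; exact (card_filter_congr fun _ _ => Iff.rfl).trans_le h2.2
  -- the algebraic core
  have hcore := triangleCertificate_core₂ θ hθ0 hθ1 (fun σ => DecisionTree.ind (G σ) ω) (fun σ => DecisionTree.ind (D₂ σ) ω)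
    (fun d σ => DecisionTree.ind (Sp d σ) ω) (DecisionTree.ind Chi ω) (C3 / C0)
    (fun d σ => DecisionTree.ind_nonneg _ _) ?_ (fun i => DecisionTree.ind_nonneg _ _) (fun i => BHK2006.ind_le_one _ _)
    ?_ ?_ ?_ ?_ (DecisionTree.ind_nonneg _ _) (div_nonneg hC3 hC0) ?_ ?_
  · -- scale the core inequality by `C0`
    have h := mul_le_mul_of_nonneg_left hcore hC0
    have hC3' : C0 * (C3 / C0 * DecisionTree.ind Chi ω) = C3 * DecisionTree.ind Chi ω := by field_simp
    rw [mul_add, hC3'] at h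
    refine le_trans (le_of_eq ?_) h
    rw [Finset.mul_sum]
    exact Finset.sum_congr rfl fun d _ => by ring
  · -- only single-star patterns are lonely
    intro σ hσ
    refine DecisionTree.ind_of_not_mem fun hω => ?_
    simp only [hD₂, mem_setOf_eq] at hω
    obtain ⟨i, rfl⟩ := portPattern_lonely_singleton' ξ A p p' σ j hj hpA hp'A hpp'
      (fun i _ k _ hik => hnopar i k hik) (hω.2.1.trans_eq (card_filter_congr fun _ _ => Iff.rfl))
      ((card_filter_congr fun _ _ => Iff.rfl).trans_le hω.2.2)
    exact hσ i rfl
  · -- a lonely-capable star has light ports (no links open)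
    exact fun i hne d hdi => hports i ∅ hne (fun k hk => absurd hk (Finset.notMem_empty k)) d hdi
  · -- a lonely-capable star has light ports (its own link open)
    exact fun i hne d hdi => hports i {i} hne (fun k hk hki => absurd (Finset.mem_singleton.1 hk) hki) d hdi
  · -- both stars at the port `q d` lonely-capable: the link of star `d` is harmless
    intro d hall
    have hl2 := (hlonelyOf (d + 2) (hall (d + 2) (fin3_facts d).2.1)).2
    have hl1 := (hlonelyOf (d + 1) (hall (d + 1) (fin3_facts d).1)).2
    refine DecisionTree.ind_of_mem ?_
    simp only [hSp, mem_setOf_eq]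
    exact (card_filter_congr fun _ _ => Iff.rfl).trans_le (triangle_link_harmless ξ A p p' q hp hp' j hj hqA hq d
      ((card_filter_congr fun _ _ => Iff.rfl).trans_le hl1) ((card_filter_congr fun _ _ => Iff.rfl).trans_le hl2))
  · -- two lonely-capable stars force the third
    intro i i' hii' hnei hnei' k
    by_cases hki : k = i
    · rw [hki]; exact hnei
    by_cases hki' : k = i'
    · rw [hki']; exact hnei'
    have hk12 : ∀ l, l ≠ k → l = k + 1 ∨ l = k + 2 := fun l hl => (fin3_ne_iff k l).1 hl
    have hne1 : DecisionTree.ind (D₂ {k + 1}) ω ≠ 0 := by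
      rcases hk12 i (Ne.symm hki) with h | h
      · rw [← h]; exact hnei
      · rcases hk12 i' (Ne.symm hki') with h' | h'
        · rw [← h']; exact hnei'
        · exact absurd (h.trans h'.symm) hii'
    have hne2 : DecisionTree.ind (D₂ {k + 2}) ω ≠ 0 := by
      rcases hk12 i (Ne.symm hki) with h | h
      · rcases hk12 i' (Ne.symm hki') with h' | h'
        · exact absurd (h.trans h'.symm) hii'
        · rw [← h']; exact hnei'
      · rw [← h]; exact hnei
    obtain ⟨hsep1, hl1⟩ := hlonelyOf (k + 1) hne1
    obtain ⟨hsep2, hl2⟩ := hlonelyOf (k + 2) hne2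
    have h3 := triangle_third_lonely ξ A p p' q hp hp' c j hj hqA hq k hsep1 ((card_filter_congr fun _ _ => Iff.rfl).trans_le hl1)
      hsep2 ((card_filter_congr fun _ _ => Iff.rfl).trans_le hl2)
    have hmem : ω ∈ D₂ {k} := by
      simp only [hD₂, mem_setOf_eq]
      exact ⟨h3.1, h3.2.1.trans_eq (card_filter_congr fun _ _ => Iff.rfl), (card_filter_congr fun _ _ => Iff.rfl).trans_le h3.2.2⟩
    rw [DecisionTree.ind_of_mem hmem]
    exact one_ne_zero
  · -- the budget ratio
    intro hS
    have h := hbudget hS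
    rw [le_div_iff₀ hC0pos]
    linarith
  · -- trichotomy for `c`
    rcases triangle_c_trichotomy ξ A p p' q hp hp' c j hj hqA hq hcA hcq with hheavy | ⟨hlight, hfar, hsmall⟩ | ⟨r, hGr, hSpr, hDr⟩
    · refine Or.inl fun σ => DecisionTree.ind_of_not_mem fun hω => ?_
      simp only [hG, mem_setOf_eq] at hω
      have := (hheavy σ).trans_le ((card_filter_congr fun _ _ => Iff.rfl).trans_le hω)
      omega
    · refine Or.inr (Or.inl ⟨fun σ => DecisionTree.ind_of_mem ?_, DecisionTree.ind_of_mem ⟨hfar, hsmall⟩⟩)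
      simp only [hG, mem_setOf_eq]
      exact (card_filter_congr fun _ _ => Iff.rfl).trans_le (hlight σ)
    · have hGiff : ∀ σ, ω ∈ G σ ↔ σ ⊆ {r} := by
        intro σ
        simp only [hG, mem_setOf_eq]
        exact (iff_of_eq (congrArg (· ≤ j) (card_filter_congr fun _ _ => Iff.rfl))).trans (hGr σ)
      refine Or.inr (Or.inr ⟨r, fun σ => ?_, fun σ => ?_, fun i hir => ?_⟩)
      · by_cases hσ : σ ⊆ {r}
        · rw [if_pos hσ]; exact DecisionTree.ind_of_mem ((hGiff σ).2 hσ)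
        · rw [if_neg hσ]; exact DecisionTree.ind_of_not_mem (fun h => hσ ((hGiff σ).1 h))
      · have hiff : ω ∈ Sp r σ ↔ ω ∈ G σ := by
          simp only [hSp, hG, mem_setOf_eq]
          constructor
          · intro h
            exact (card_filter_congr fun _ _ => Iff.rfl).trans_le ((hSpr σ).1 ((card_filter_congr fun _ _ => Iff.rfl).trans_le h))
          · intro h
            exact (card_filter_congr fun _ _ => Iff.rfl).trans_le ((hSpr σ).2 ((card_filter_congr fun _ _ => Iff.rfl).trans_le h))
        by_cases hω : ω ∈ Sp r σ
        · rw [DecisionTree.ind_of_mem hω, DecisionTree.ind_of_mem (hiff.1 hω)]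
        · rw [DecisionTree.ind_of_not_mem hω, DecisionTree.ind_of_not_mem (fun h => hω (hiff.2 h))]
      · refine DecisionTree.ind_of_not_mem fun hω => ?_
        simp only [hD₂, mem_setOf_eq] at hω
        obtain ⟨u, hu, hcu⟩ := hDr i hir
        exact hω.1 u hu hcu

/-- **The comonotone word with hair budget is nonnegative for the TRIANGLE (level `j ≤ 2`).**  Three two-port pendant stars `s i ∉ A`
(`i : Fin 3`) with ports `p i = q (i+1)`, `p' i = q (i+2)` on three distinct relays `q d`, `c ∈ A` off the ports dominating them, and
constants `C0, C3 ≥ 0` with `Σ_i θ_i > 2 → C0 ≤ 2·C3` (`θ_i = w(s i,p i)·w(s i,p' i)`).  Then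
`0 ≤ C0 · Σ_σ w(σ)·[μ(c ↮_ξ P_σ, |π_ξ(c)| ≤ j) − μ(c ↮_ξ P_σ, 1 ≤ |π_ξ(P_σ)| ≤ j)] + C3 · μ(c ↮_ξ {q d}, |π_ξ(c)| ≤ j)`.
[cite: VandenbergHaggstromKahn2005, Thm. 1.5 (p. 7) — only through the domination hypothesis; the step itself is elementary;
seat memo TRIANGLE-PROOF.md §2–§5] -/
theorem comonotone_word_budget_triangle (w : Sym2 (Fin n) → unitInterval) (A : Finset (Fin n)) (s p p' q : Fin 3 → Fin n)
    (hp : ∀ i, p i = q (i + 1)) (hp' : ∀ i, p' i = q (i + 2))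
    (c : Fin n) (j : ℕ) (hj : j ≤ 2) (hs : Function.Injective s) (hsA : ∀ i, s i ∉ A)
    (hqA : ∀ d, q d ∈ A) (hq : Function.Injective q) (hcA : c ∈ A) (hcq : ∀ d, c ≠ q d)
    (hwjunk : ∀ i u, u ≠ s i → u ≠ p i → u ≠ p' i → w s(s i, u) = 0)
    (hdom : ∀ d, (prodBernoulli w).real {ω : BondConfig (Fin n) | (A.filter fun z => ω ∈ openConn (q d) z).card ≤ j} ≤
      (prodBernoulli w).real {ω : BondConfig (Fin n) | (A.filter fun z => ω ∈ openConn c z).card ≤ j})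
    (C0 C3 : ℝ) (hC0 : 0 ≤ C0) (hC3 : 0 ≤ C3)
    (hbudget : 2 < ∑ i, (w s(s i, p i) : ℝ) * w s(s i, p' i) → C0 ≤ 2 * C3) :
    0 ≤ C0 * ∑ σ ∈ (Finset.univ : Finset (Fin 3)).powerset,
        ((∏ i ∈ σ, ((w s(s i, p i) : ℝ) * w s(s i, p' i))) * ∏ i ∈ Finset.univ \ σ, (1 - (w s(s i, p i) : ℝ) * w s(s i, p' i))) *
        ((prodBernoulli w).real {ω : BondConfig (Fin n) |
            (∀ u ∈ σ.image p ∪ σ.image p', ¬ (openGraph (ω ∩ {e | ∀ v ∈ Finset.univ.image s, v ∉ e})).Reachable c u) ∧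
            (A.filter fun z => (openGraph (ω ∩ {e | ∀ v ∈ Finset.univ.image s, v ∉ e})).Reachable c z).card ≤ j} -
          (prodBernoulli w).real {ω : BondConfig (Fin n) |
            (∀ u ∈ σ.image p ∪ σ.image p', ¬ (openGraph (ω ∩ {e | ∀ v ∈ Finset.univ.image s, v ∉ e})).Reachable c u) ∧
            1 ≤ (A.filter fun z => ∃ u ∈ σ.image p ∪ σ.image p',
              (openGraph (ω ∩ {e | ∀ v ∈ Finset.univ.image s, v ∉ e})).Reachable u z).card ∧
            (A.filter fun z => ∃ u ∈ σ.image p ∪ σ.image p',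
              (openGraph (ω ∩ {e | ∀ v ∈ Finset.univ.image s, v ∉ e})).Reachable u z).card ≤ j}) +
      C3 * (prodBernoulli w).real {ω : BondConfig (Fin n) |
          (∀ d, ¬ (openGraph (ω ∩ {e | ∀ v ∈ Finset.univ.image s, v ∉ e})).Reachable c (q d)) ∧
          (A.filter fun z => (openGraph (ω ∩ {e | ∀ v ∈ Finset.univ.image s, v ∉ e})).Reachable c z).card ≤ j} := by
  -- port facts
  have hpA : ∀ i, p i ∈ A := fun i => (hp i) ▸ hqA (i + 1)
  have hp'A : ∀ i, p' i ∈ A := fun i => (hp' i) ▸ hqA (i + 2)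
  have hpp' : ∀ i, p i ≠ p' i := fun i h => (fin3_facts i).2.2.1 (hq (((hp i).symm.trans h).trans (hp' i)))
  have hps : ∀ i k, p i ≠ s k := fun i k h => hsA k (h ▸ hpA i)
  have hp's : ∀ i k, p' i ≠ s k := fun i k h => hsA k (h ▸ hp'A i)
  have hqs : ∀ d k, q d ≠ s k := fun d k h => hsA k (h ▸ hqA d)
  have hcs : ∀ i, c ≠ s i := fun i h => hsA i (h ▸ hcA)
  -- abbreviations
  set θ : Fin 3 → ℝ := fun i => (w s(s i, p i) : ℝ) * w s(s i, p' i) with hθ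
  set W : Finset (Fin 3) → ℝ := fun σ => (∏ i ∈ σ, θ i) * ∏ i ∈ Finset.univ \ σ, (1 - θ i) with hW
  set x : Fin 3 → ℝ := fun d => C0 * (if ∑ i, θ i ≤ 2 then (1 - θ d) / (3 - ∑ i, θ i) else 1 / 2) with hx
  have hθ1 : ∀ i, θ i ≤ 1 := fun i => mul_le_one₀ (w _).2.2 (w _).2.1 (w _).2.2
  have hxnn : ∀ d, 0 ≤ x d := by
    intro d
    simp only [hx]
    refine mul_nonneg hC0 ?_
    split_ifs with h
    · have hS3 : ∑ i, θ i ≤ 2 := h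
      exact div_nonneg (sub_nonneg.2 (hθ1 d)) (by linarith)
    · norm_num
  set G : Finset (Fin 3) → Set (BondConfig (Fin n)) := fun σ => {ω' |
    (A.filter fun z => (openGraph ((ω' ∩ {e | ∀ v ∈ Finset.univ.image s, v ∉ e}) ∪
      ↑(σ.image fun i => (s(p i, p' i) : Sym2 (Fin n))))).Reachable c z).card ≤ j} with hG
  set Sp : Fin 3 → Finset (Fin 3) → Set (BondConfig (Fin n)) := fun d σ => {ω' |
    (A.filter fun z => (openGraph ((ω' ∩ {e | ∀ v ∈ Finset.univ.image s, v ∉ e}) ∪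
      ↑(σ.image fun i => (s(p i, p' i) : Sym2 (Fin n))))).Reachable (q d) z).card ≤ j} with hSp
  set D₁ : Finset (Fin 3) → Set (BondConfig (Fin n)) := fun σ => {ω' |
    (∀ u ∈ σ.image p ∪ σ.image p', ¬ (openGraph (ω' ∩ {e | ∀ v ∈ Finset.univ.image s, v ∉ e})).Reachable c u) ∧
      (A.filter fun z => (openGraph (ω' ∩ {e | ∀ v ∈ Finset.univ.image s, v ∉ e})).Reachable c z).card ≤ j} with hD₁
  set D₂ : Finset (Fin 3) → Set (BondConfig (Fin n)) := fun σ => {ω' |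
    (∀ u ∈ σ.image p ∪ σ.image p', ¬ (openGraph (ω' ∩ {e | ∀ v ∈ Finset.univ.image s, v ∉ e})).Reachable c u) ∧
      1 ≤ (A.filter fun z => ∃ u ∈ σ.image p ∪ σ.image p',
        (openGraph (ω' ∩ {e | ∀ v ∈ Finset.univ.image s, v ∉ e})).Reachable u z).card ∧
      (A.filter fun z => ∃ u ∈ σ.image p ∪ σ.image p',
        (openGraph (ω' ∩ {e | ∀ v ∈ Finset.univ.image s, v ∉ e})).Reachable u z).card ≤ j} with hD₂
  set Chi : Set (BondConfig (Fin n)) := {ω' |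
    (∀ d, ¬ (openGraph (ω' ∩ {e | ∀ v ∈ Finset.univ.image s, v ∉ e})).Reachable c (q d)) ∧
      (A.filter fun z => (openGraph (ω' ∩ {e | ∀ v ∈ Finset.univ.image s, v ∉ e})).Reachable c z).card ≤ j} with hChi
  change 0 ≤ C0 * ∑ σ ∈ (Finset.univ : Finset (Fin 3)).powerset, W σ * ((prodBernoulli w).real (D₁ σ) - (prodBernoulli w).real (D₂ σ)) +
    C3 * (prodBernoulli w).real Chi
  -- (1) the pointwise certificate
  have hpt : ∀ ω : BondConfig (Fin n),
      ∑ d, x d * ∑ σ ∈ (Finset.univ : Finset (Fin 3)).powerset, W σ * (DecisionTree.ind (G σ) ω - DecisionTree.ind (Sp d σ) ω) ≤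
        C0 * ∑ σ ∈ (Finset.univ : Finset (Fin 3)).powerset, W σ * (DecisionTree.ind (D₁ σ) ω - DecisionTree.ind (D₂ σ) ω) +
          C3 * DecisionTree.ind Chi ω :=
    fun ω => triangle_certificate_pointwise w A s p p' q hp hp' c j hj hqA hq hcA hcq C0 C3 hC0 hC3 hbudget ω
  -- (2) integrate
  have hwt0 : ∀ e : Sym2 (Fin n), 0 ≤ ((w e : unitInterval) : ℝ) := fun e => (w e).2.1
  have hwt1 : ∀ e : Sym2 (Fin n), ((w e : unitInterval) : ℝ) ≤ 1 := fun e => (w e).2.2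
  have hupper : C0 * ∑ σ ∈ (Finset.univ : Finset (Fin 3)).powerset, W σ * ((prodBernoulli w).real (D₁ σ) - (prodBernoulli w).real (D₂ σ)) +
      C3 * (prodBernoulli w).real Chi =
      ∑ ω : BondConfig (Fin n), BHK2006.weight (fun e => (w e : ℝ)) ω *
        (C0 * ∑ σ ∈ (Finset.univ : Finset (Fin 3)).powerset, W σ * (DecisionTree.ind (D₁ σ) ω - DecisionTree.ind (D₂ σ) ω) +
          C3 * DecisionTree.ind Chi ω) := by
    rw [linkSum_real_sub_eq_sum w W D₁ D₂, LonePortSum.measureReal_eq_sum w Chi, Finset.mul_sum, Finset.mul_sum, ← Finset.sum_add_distrib]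
    refine Finset.sum_congr rfl fun ω _ => ?_
    ring
  have hlower : ∑ d, x d * ∑ σ ∈ (Finset.univ : Finset (Fin 3)).powerset, W σ * ((prodBernoulli w).real (G σ) - (prodBernoulli w).real (Sp d σ)) =
      ∑ ω : BondConfig (Fin n), BHK2006.weight (fun e => (w e : ℝ)) ω *
        ∑ d, x d * ∑ σ ∈ (Finset.univ : Finset (Fin 3)).powerset, W σ * (DecisionTree.ind (G σ) ω - DecisionTree.ind (Sp d σ) ω) := by
    calc ∑ d, x d * ∑ σ ∈ (Finset.univ : Finset (Fin 3)).powerset, W σ * ((prodBernoulli w).real (G σ) - (prodBernoulli w).real (Sp d σ))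
        = ∑ d, ∑ ω : BondConfig (Fin n), x d * (BHK2006.weight (fun e => (w e : ℝ)) ω *
            ∑ σ ∈ (Finset.univ : Finset (Fin 3)).powerset, W σ * (DecisionTree.ind (G σ) ω - DecisionTree.ind (Sp d σ) ω)) := by
          refine Finset.sum_congr rfl fun d _ => ?_
          rw [linkSum_real_sub_eq_sum w W G (Sp d), Finset.mul_sum]
      _ = ∑ ω : BondConfig (Fin n), ∑ d, x d * (BHK2006.weight (fun e => (w e : ℝ)) ω *
            ∑ σ ∈ (Finset.univ : Finset (Fin 3)).powerset, W σ * (DecisionTree.ind (G σ) ω - DecisionTree.ind (Sp d σ) ω)) :=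
          Finset.sum_comm
      _ = _ := by
          refine Finset.sum_congr rfl fun ω _ => ?_
          rw [Finset.mul_sum]
          refine Finset.sum_congr rfl fun d _ => ?_
          ring
  have hint : ∑ d, x d * ∑ σ ∈ (Finset.univ : Finset (Fin 3)).powerset, W σ * ((prodBernoulli w).real (G σ) - (prodBernoulli w).real (Sp d σ)) ≤
      C0 * ∑ σ ∈ (Finset.univ : Finset (Fin 3)).powerset, W σ * ((prodBernoulli w).real (D₁ σ) - (prodBernoulli w).real (D₂ σ)) +
        C3 * (prodBernoulli w).real Chi := by
    rw [hupper, hlower]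
    exact Finset.sum_le_sum fun ω _ => mul_le_mul_of_nonneg_left (hpt ω) (BHK2006.weight_nonneg hwt0 hwt1 ω)
  -- (3) the lower side is `Σ_d x_d (I(c) − I(q d)) ≥ 0`
  have hIc : (prodBernoulli w).real {ω : BondConfig (Fin n) | (A.filter fun z => ω ∈ openConn c z).card ≤ j} =
      ∑ σ ∈ (Finset.univ : Finset (Fin 3)).powerset, W σ * (prodBernoulli w).real (G σ) := by
    have h := lightness_eq_linkSum w A s p p' c j hs hps hp's hpp' hwjunk hsA hcs
    rw [hG]
    convert h using 12
    exact Iff.rfl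
  have hIq : ∀ d, (prodBernoulli w).real {ω : BondConfig (Fin n) | (A.filter fun z => ω ∈ openConn (q d) z).card ≤ j} =
      ∑ σ ∈ (Finset.univ : Finset (Fin 3)).powerset, W σ * (prodBernoulli w).real (Sp d σ) := by
    intro d
    have h := lightness_eq_linkSum w A s p p' (q d) j hs hps hp's hpp' hwjunk hsA (hqs d)
    rw [hSp]
    convert h using 12
    exact Iff.rfl
  have hlb : 0 ≤ ∑ d, x d * ∑ σ ∈ (Finset.univ : Finset (Fin 3)).powerset, W σ * ((prodBernoulli w).real (G σ) - (prodBernoulli w).real (Sp d σ)) := by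
    refine Finset.sum_nonneg fun d _ => mul_nonneg (hxnn d) ?_
    have heq : ∑ σ ∈ (Finset.univ : Finset (Fin 3)).powerset, W σ * ((prodBernoulli w).real (G σ) - (prodBernoulli w).real (Sp d σ)) =
        (prodBernoulli w).real {ω : BondConfig (Fin n) | (A.filter fun z => ω ∈ openConn c z).card ≤ j} -
          (prodBernoulli w).real {ω : BondConfig (Fin n) | (A.filter fun z => ω ∈ openConn (q d) z).card ≤ j} := by
      rw [hIc, hIq d, ← Finset.sum_sub_distrib]
      refine Finset.sum_congr rfl fun σ _ => ?_
      ring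
    rw [heq]
    exact sub_nonneg.2 (hdom d)
  exact le_trans hlb hint

end StarSet

end Summit.CriticalPhenomena.PercolationContinuityZ3.Theorems

end
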